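import Summits.HodgeConjecture.HodgeConjecture.Theorems.MarkmanPartnerTransportLowPicardRMExact
import Summits.HodgeConjecture.HodgeConjecture.Theorems.MarkmanPartnerTransportLowPicardRMTrichotomy

/-!
# Route MarkmanPartnerTransport · crux #5 `LowPicardRealMultiplication` — «CELL-GEN»: inside a cell, ONE rational
# type-preserving endomorphism whose `σ`-eigenvalue has degree `[E:ℚ]` generates the transcendental Hodge endomorphisms

Planner p1 g39 GO «CELL-GEN SOCKET» (2026-08-28T16:43Z); prover seat hodge-nonav-20241-p1 (gen 15). Route-independent
core (no `Theses` import; notations copied verbatim). For a marked smooth projective `(X, φ, P, z)` (clauses (m1)–(m6); NO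
`K3^{[2]}`-type hypothesis), `RMgen[X, φ, z, d]` with generator `θ` (`θ σ = ev_θ σ`, `deg minpoly_ℚ ev_θ = d`, GEN: every
rational type-preserving endomorphism is a rational polynomial of degree `< d` in `θ` on the `T`-domain
`{y : q(φ y, φ N¹) = 0}`), and a rational type-preserving `t` with `t σ = ev σ`, `deg minpoly_ℚ ev = d`:

* `genX_of_rmGenerator_of_eigenvalue_natDegree` — **`GenX[X, φ, t]`**: every admissible rational Hodge endomorphism is
  a rational polynomial in `t` on the `T`-domain (the `hgen` of the `X`-side F4 `hodgeConjectureFor_of_cycleInducedGenerator`).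
  Proof (elementary over the tree): GEN gives `t = P(θ)` on `T` for some `P ∈ ℚ[X]`, so `ev = P(ev_θ)` (apply at
  `σ ∈ T`); in `ℂ`, `ℚ(ev) ⊆ ℚ(ev_θ)` have the same degree `d ≥ 1` (`d = 0` is excluded by GEN at `σ ≠ 0`), hence
  `ev_θ = Q(ev)` for some `Q ∈ ℚ[X]` (`exists_aeval_eq_of_natDegree_minpoly_eq`); the rational `(1,1)`-preserving
  endomorphism `G := (Q ∘ P)(θ) − θ` kills `σ`, so it VANISHES on the `T`-domain
  (`eq_ratSmul_on_transcendental_of_apply_period` with the rational eigenvalue `0` — Zarhin's injectivity of the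
  `(2,0)`-character, a tree theorem); hence `θ = Q(P(θ)) = Q(t)` on `T`, powers of `θ` are polynomials in `t` there,
  and GEN for any `f` rewrites as a rational polynomial in `t`.

Helpers (rational polynomials in an endomorphism: rationality, Hodge types, eigenvalues; agreement and invariance on a
stable subspace; unfolding into a `Fin`-sum; the degree-count lemma in `ℂ`) are stated separately for reuse. No
definition, no sorry, no named-fact hypothesis. Consumer: `…LowPicardRMCellGenSocket` (one generating cycle per
member ⟹ HC⁴ on EVERY cell of crux #5, no degree law, no Kuga–Satake). `--supports stmt-HodgeConjecture-19653`.
Nothing here proves the crux or HC.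

References: Yu. Zarhin, J. reine angew. Math. 341 (1983) Thm. 1.5.1; D. Huybrechts, *Lectures on K3 Surfaces*, Ch. 3
Cor. 3.3.6, Lemma 3.3.1; B. van Geemen, Michigan Math. J. 56 (2008) Lemma 3.2.
-/

noncomputable section

set_option linter.dupNamespace false

open Module CategoryTheory Polynomial
open Literature.AlgebraicTopology.SingularHomology Literature.Geometry.Kaehler
open Literature.AlgebraicGeometry Literature.AlgebraicGeometry.Motives Literature.AlgebraicGeometry.HodgeTheory
open Literature.AlgebraicGeometry.Hyperkaehler Literature.AlgebraicGeometry.Surfaces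
open Summit.HodgeConjecture.HodgeConjecture.Theorems.NikulinTwinTransport

namespace Summit.HodgeConjecture.HodgeConjecture.Theorems.MarkmanPartnerTransport.PartnerLattice

/-- `MarkedK3Sq[X, φ, P, z]`: VERBATIM the `let MarkedK3Sq := …` binder of the route declarations of
MarkmanPartnerTransport (clauses (m1)–(m6)). Local notation only. -/
local notation3 (prettyPrint := false) "MarkedK3Sq[" X ", " φ ", " P ", " z "]" =>
  (((IsIntegralClass P ∧ ∀ Q : complexBetti X (2 * 4), IsIntegralClass Q → ∃ n : ℤ, Q = n • P) ∧
    (∀ c : complexBetti X 2, IsIntegralClass c ↔ ∃ v : K3HilbertIndex → ℤ, φ c = fun i => (v i : ℂ)) ∧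
    (∀ a : complexBetti X 2, cupPowTwo a 4 = ((3 : ℂ) * (k3HilbertForm 2 (φ a) (φ a)) ^ 2) • P) ∧
    (IsOfHodgeType 4 X 2 2 0 (LinearEquiv.symm φ z) ∧
      ∀ τ : complexBetti X 2, IsOfHodgeType 4 X 2 2 0 τ → ∃ t : ℂ, τ = t • LinearEquiv.symm φ z) ∧
    (∀ c : complexBetti X 2, IsOfHodgeType 4 X 2 1 1 c ↔
      (k3HilbertForm 2 (φ c) z = 0 ∧ k3HilbertForm 2 (φ c) (star z) = 0)) ∧
    (k3HilbertForm 2 z z = 0 ∧ 0 < (k3HilbertForm 2 (star z) z).re)))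

/-- `RMgen[X, φ, z, d]` (VERBATIM `…LowPicardRMCells` ∕ `…LowPicardRMExact`). Local notation only. -/
local notation3 (prettyPrint := false) "RMgen[" X ", " φ ", " z ", " d "]" =>
  (∃ θ : complexBetti X 2 →ₗ[ℂ] complexBetti X 2, (∀ y, IsRationalClass y → IsRationalClass (θ y)) ∧
    (∀ (i j : ℕ) y, IsOfHodgeType 4 X 2 i j y → IsOfHodgeType 4 X 2 i j (θ y)) ∧
    (∀ y w : complexBetti X 2, k3HilbertForm 2 (φ (θ y)) (φ w) = k3HilbertForm 2 (φ y) (φ (θ w))) ∧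
    ∃ ev : ℂ, θ (LinearEquiv.symm φ z) = ev • LinearEquiv.symm φ z ∧ ev.im = 0 ∧
      (minpoly ℚ ev).natDegree = d ∧
      (∃ n : ℕ, 3 ≤ n ∧ d * n + Module.finrank ℂ ↥(algebraicClasses X 1) = 23) ∧
      ∀ f : complexBetti X 2 →ₗ[ℂ] complexBetti X 2, (∀ y, IsRationalClass y → IsRationalClass (f y)) →
        (∀ (i j : ℕ) y, IsOfHodgeType 4 X 2 i j y → IsOfHodgeType 4 X 2 i j (f y)) →
        ∃ c : Fin d → ℚ, ∀ y : complexBetti X 2,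
          (∀ a : complexBetti X 2, a ∈ algebraicClasses X 1 → k3HilbertForm 2 (φ y) (φ a) = 0) →
            f y = ∑ i : Fin d, ((c i : ℂ) • (θ ^ (i : ℕ)) y))

/-- `GenX[X, φ, e]` (VERBATIM `…K3Sq2OneCycle`): "every rational Hodge endomorphism of `H²(X)` killing `N¹(X)` with
image `q`-orthogonal to `N¹(X)` is a rational polynomial in `e` on `T(X)`" — the hypothesis `hgen` of
`hodgeConjectureFor_of_cycleInducedGenerator`. Local notation only. -/
local notation3 (prettyPrint := false) "GenX[" X ", " φ ", " e "]" =>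
  (∀ f : complexBetti X 2 →ₗ[ℂ] complexBetti X 2, (∀ y, IsRationalClass y → IsRationalClass (f y)) →
      (∀ (i j : ℕ) y, IsOfHodgeType 4 X 2 i j y → IsOfHodgeType 4 X 2 i j (f y)) →
      (∀ d : complexBetti X 2, d ∈ algebraicClasses X 1 → f d = 0) →
      (∀ y : complexBetti X 2, ∀ d : complexBetti X 2, d ∈ algebraicClasses X 1 →
        k3HilbertForm 2 (φ (f y)) (φ d) = 0) →
      ∃ (n : ℕ) (a : Fin n → ℚ), ∀ y : complexBetti X 2,
        (∀ d : complexBetti X 2, d ∈ algebraicClasses X 1 → k3HilbertForm 2 (φ y) (φ d) = 0) →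
        f y = ∑ i : Fin n, ((a i : ℂ) • (e ^ (i : ℕ)) y))

variable {X : SchemeOver ℂ} {φ : complexBetti X 2 ≃ₗ[ℂ] (K3HilbertIndex → ℂ)} {P : complexBetti X (2 * 4)}
  {z : K3HilbertIndex → ℂ}

/-! ### Helpers: rational polynomials in an endomorphism of `H²(X(ℂ); ℂ)`
(`isRationalClass_pow_apply`, `isOfHodgeType_pow_apply` are KAPPA-ANY's, `…HodgeClassesModKappaClassesAnyDegree`) -/

/-- **A rational polynomial in `θ`, evaluated** — `(P.map (ℚ → ℂ))(θ)` applied to a class: rational classes go to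
rational classes, Hodge types are preserved, and an eigenvector `σ` of `θ` with eigenvalue `ev` is an eigenvector with
eigenvalue `P(ev)`. [folklore] -/
theorem aeval_ratPoly_apply (hX : IsSmoothProjective 4 X) (θ : complexBetti X 2 →ₗ[ℂ] complexBetti X 2)
    (h1 : ∀ y, IsRationalClass y → IsRationalClass (θ y))
    (h2 : ∀ (i j : ℕ) y, IsOfHodgeType 4 X 2 i j y → IsOfHodgeType 4 X 2 i j (θ y))
    {σ : complexBetti X 2} {ev : ℂ} (hσ : θ σ = ev • σ) (p : ℚ[X]) :
    (∀ y, IsRationalClass y → IsRationalClass (aeval θ (p.map (algebraMap ℚ ℂ)) y)) ∧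
    (∀ (i j : ℕ) y, IsOfHodgeType 4 X 2 i j y → IsOfHodgeType 4 X 2 i j (aeval θ (p.map (algebraMap ℚ ℂ)) y)) ∧
    aeval θ (p.map (algebraMap ℚ ℂ)) σ = (aeval ev p) • σ := by
  induction p using Polynomial.induction_on' with
  | add p q hp hq =>
    obtain ⟨hp1, hp2, hp3⟩ := hp
    obtain ⟨hq1, hq2, hq3⟩ := hq
    refine ⟨fun y hy => ?_, fun i j y hy => ?_, ?_⟩
    · rw [Polynomial.map_add, map_add, LinearMap.add_apply]
      exact (hp1 y hy).add (hq1 y hy)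
    · rw [Polynomial.map_add, map_add, LinearMap.add_apply]
      exact (hp2 i j y hy).add hX (hq2 i j y hy)
    · rw [Polynomial.map_add, map_add, LinearMap.add_apply, hp3, hq3, map_add, add_smul]
  | monomial n a =>
    have happ : ∀ y, aeval θ ((monomial n a).map (algebraMap ℚ ℂ)) y = (a : ℂ) • (θ ^ n) y := by
      intro y
      rw [Polynomial.map_monomial, aeval_monomial, Module.End.mul_apply, Module.algebraMap_end_apply, eq_ratCast]
    refine ⟨fun y hy => ?_, fun i j y hy => ?_, ?_⟩
    · rw [happ]
      exact (isRationalClass_pow_apply θ h1 n y hy).smul a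
    · rw [happ]
      exact (isOfHodgeType_pow_apply θ h2 n i j y hy).smul _
    · rw [happ, pow_apply_of_eigen θ hσ n, smul_smul, aeval_monomial, eq_ratCast]

/-- **Agreement of powers on an invariant subspace**: if `u = w` on a subspace `T` stable under `w`, then `uⁿ = wⁿ`
on `T` (and `wⁿ` preserves `T`). [folklore] -/
theorem pow_apply_eq_of_eqOn (T : Submodule ℂ (complexBetti X 2)) (u w : complexBetti X 2 →ₗ[ℂ] complexBetti X 2)
    (huw : ∀ y ∈ T, u y = w y) (hwT : ∀ y ∈ T, w y ∈ T) :
    ∀ (n : ℕ) (y : complexBetti X 2), y ∈ T → (u ^ n) y = (w ^ n) y ∧ (w ^ n) y ∈ T := by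
  intro n
  induction n with
  | zero => intro y hy; exact ⟨by rw [pow_zero, pow_zero], by rwa [pow_zero, Module.End.one_apply]⟩
  | succ n ih =>
    intro y hy
    obtain ⟨h1, h2⟩ := ih y hy
    refine ⟨?_, ?_⟩
    · rw [pow_succ', pow_succ', Module.End.mul_apply, Module.End.mul_apply, h1, huw _ h2]
    · rw [pow_succ', Module.End.mul_apply]
      exact hwT _ h2

/-- **Agreement of polynomials on an invariant subspace**: if `u = w` on a subspace `T` stable under `w`, then
`p(u) = p(w)` on `T` for every `p ∈ ℂ[X]`, and `p(w)` preserves `T`. [folklore] -/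
theorem aeval_apply_eq_of_eqOn (T : Submodule ℂ (complexBetti X 2)) (u w : complexBetti X 2 →ₗ[ℂ] complexBetti X 2)
    (huw : ∀ y ∈ T, u y = w y) (hwT : ∀ y ∈ T, w y ∈ T) (p : ℂ[X]) :
    ∀ y ∈ T, aeval u p y = aeval w p y ∧ aeval w p y ∈ T := by
  induction p using Polynomial.induction_on' with
  | add p q hp hq =>
    intro y hy
    obtain ⟨hp1, hp2⟩ := hp y hy
    obtain ⟨hq1, hq2⟩ := hq y hy
    refine ⟨?_, ?_⟩
    · rw [map_add, map_add, LinearMap.add_apply, LinearMap.add_apply, hp1, hq1]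
    · rw [map_add, LinearMap.add_apply]
      exact T.add_mem hp2 hq2
  | monomial n a =>
    intro y hy
    obtain ⟨h1, h2⟩ := pow_apply_eq_of_eqOn T u w huw hwT n y hy
    refine ⟨?_, ?_⟩
    · rw [aeval_monomial, aeval_monomial, Module.End.mul_apply, Module.End.mul_apply, Module.algebraMap_end_apply,
        Module.algebraMap_end_apply, h1]
    · rw [aeval_monomial, Module.End.mul_apply, Module.algebraMap_end_apply]
      exact T.smul_mem _ h2

/-- **A rational polynomial in `t`, unfolded as a finite `ℚ`-combination of powers of `t`** (the shape `GenX` asks for).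
[folklore] -/
theorem exists_fin_sum_eq_aeval_ratPoly (t : complexBetti X 2 →ₗ[ℂ] complexBetti X 2) (R : ℚ[X]) :
    ∃ (n : ℕ) (a : Fin n → ℚ), ∀ y : complexBetti X 2,
      aeval t (R.map (algebraMap ℚ ℂ)) y = ∑ i : Fin n, ((a i : ℂ) • (t ^ (i : ℕ)) y) := by
  refine ⟨(R.map (algebraMap ℚ ℂ)).natDegree + 1, fun i => R.coeff i, fun y => ?_⟩
  rw [aeval_eq_sum_range, LinearMap.sum_apply, ← Finset.sum_range fun i => ((R.coeff i : ℚ) : ℂ) • (t ^ i) y]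
  refine Finset.sum_congr rfl fun i _ => ?_
  rw [LinearMap.smul_apply, Polynomial.coeff_map, eq_ratCast]

/-- **Degree count in `ℂ`**: if `y = P(x)` for a rational polynomial `P` and `x`, `y` are algebraic over `ℚ` of the
SAME degree `d ≥ 1`, then `ℚ(y) = ℚ(x)`, so `x = Q(y)` for some `Q ∈ ℚ[X]`. [folklore] -/
theorem exists_aeval_eq_of_natDegree_minpoly_eq {x y : ℂ} {P : ℚ[X]} (hxy : y = aeval x P) {d : ℕ} (hd : 1 ≤ d)
    (hx : (minpoly ℚ x).natDegree = d) (hy : (minpoly ℚ y).natDegree = d) : ∃ Q : ℚ[X], aeval y Q = x := by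
  have hxi : IsIntegral ℚ x := by
    by_contra h
    rw [minpoly.eq_zero h, Polynomial.natDegree_zero] at hx
    omega
  have hyi : IsIntegral ℚ y := by
    by_contra h
    rw [minpoly.eq_zero h, Polynomial.natDegree_zero] at hy
    omega
  have hle : IntermediateField.adjoin ℚ {y} ≤ IntermediateField.adjoin ℚ {x} := by
    rw [IntermediateField.adjoin_simple_le_iff]
    have h : y ∈ (IntermediateField.adjoin ℚ {x}).toSubalgebra := by
      apply IntermediateField.algebra_adjoin_le_adjoin
      rw [Algebra.adjoin_singleton_eq_range_aeval]
      exact ⟨P, hxy.symm⟩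
    exact h
  haveI : FiniteDimensional ℚ (IntermediateField.adjoin ℚ {x}) := IntermediateField.adjoin.finiteDimensional hxi
  have heq : IntermediateField.adjoin ℚ {y} = IntermediateField.adjoin ℚ {x} :=
    IntermediateField.eq_of_le_of_finrank_eq hle
      (by rw [IntermediateField.adjoin.finrank hxi, IntermediateField.adjoin.finrank hyi, hx, hy])
  have hx_mem : x ∈ (IntermediateField.adjoin ℚ {y}).toSubalgebra := by
    rw [heq]
    exact IntermediateField.mem_adjoin_simple_self ℚ x
  rw [IntermediateField.adjoin_simple_toSubalgebra_of_isAlgebraic hyi.isAlgebraic, Algebra.adjoin_singleton_eq_range_aeval]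
    at hx_mem
  obtain ⟨Q, hQ⟩ := hx_mem
  exact ⟨Q, hQ⟩

/-! ### «CELL-GEN»: an endomorphism whose eigenvalue has the degree of the RM field generates the Hodge endomorphisms -/

/-- **«CELL-GEN»** (module docstring): for a marked smooth projective `(X, φ, P, z)` with `RMgen[X, φ, z, d]` and a
rational type-preserving endomorphism `t` with `t σ = ev σ`, `deg minpoly_ℚ ev = d`: **`GenX[X, φ, t]`** — every
admissible rational Hodge endomorphism is a rational polynomial in `t` on the `T`-domain. No `K3^{[2]}`-type hypothesis,
no degree law, no parity. [cite: Zarhin1983HodgeGroupsK3, Thm. 1.5.1] [cite: Huybrechts2016K3, Ch. 3 Cor. 3.3.6 and Lemma 3.3.1]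
[cite: Vangeemen2008, Lemma 3.2] -/
theorem genX_of_rmGenerator_of_eigenvalue_natDegree (hX : IsSmoothProjective 4 X) (hM : MarkedK3Sq[X, φ, P, z])
    {d : ℕ} (hR : RMgen[X, φ, z, d]) (t : complexBetti X 2 →ₗ[ℂ] complexBetti X 2)
    (ht_rat : ∀ y, IsRationalClass y → IsRationalClass (t y))
    (ht_typ : ∀ (i j : ℕ) y, IsOfHodgeType 4 X 2 i j y → IsOfHodgeType 4 X 2 i j (t y))
    {ev : ℂ} (ht_ev : t (LinearEquiv.symm φ z) = ev • LinearEquiv.symm φ z) (hdeg : (minpoly ℚ ev).natDegree = d) :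
    GenX[X, φ, t] := by
  classical
  obtain ⟨-, -, -, -, h11, -, hzpos⟩ := id hM
  obtain ⟨θ, h1, h2, h5, evθ, hθσ, -, hdegθ, -, hG⟩ := hR
  -- `σ ≠ 0`
  have hzne : z ≠ 0 := by
    intro h0
    rw [h0, k3HilbertForm_eq_dotProduct] at hzpos
    simp at hzpos
  have hσne : (LinearEquiv.symm φ z) ≠ 0 := fun h => hzne (by simpa using congrArg φ h)
  -- the `T`-domain as a subspace; `σ ∈ T`
  let T : Submodule ℂ (complexBetti X 2) :=
    { carrier := {y | ∀ a : complexBetti X 2, a ∈ algebraicClasses X 1 → k3HilbertForm 2 (φ y) (φ a) = 0}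
      add_mem' := fun {y y'} hy hy' a ha => by
        simp only [Set.mem_setOf_eq] at hy hy' ⊢
        rw [map_add, k3HilbertForm_add_left, hy a ha, hy' a ha, add_zero]
      zero_mem' := fun a ha => by
        rw [map_zero, k3HilbertForm_eq_dotProduct]
        simp
      smul_mem' := fun c y hy a ha => by
        simp only [Set.mem_setOf_eq] at hy ⊢
        rw [map_smul, k3HilbertForm_smul_left, hy a ha, mul_zero] }
  have memT : ∀ y, y ∈ T ↔ ∀ a : complexBetti X 2, a ∈ algebraicClasses X 1 → k3HilbertForm 2 (φ y) (φ a) = 0 :=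
    fun y => Iff.rfl
  have hN11 : ∀ a ∈ algebraicClasses X 1, IsOfHodgeType 4 X 2 1 1 a := fun a ha =>
    isOfHodgeType_of_mem_algebraicClasses_of_isSmoothProjective hX 1 ha
  have hσT : (LinearEquiv.symm φ z) ∈ T := by
    rw [memT]
    intro a ha
    rw [LinearEquiv.apply_symm_apply, k3HilbertForm_comm]
    exact ((h11 a).1 (hN11 a ha)).1
  -- `θ` preserves `N¹` and `T`
  have hθN : ∀ a ∈ algebraicClasses X 1, θ a ∈ algebraicClasses X 1 :=
    map_mem_algebraicClasses_one_of_rational_hodge hX θ h1 (h2 1 1)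
  have hθT : ∀ y ∈ T, θ y ∈ T := fun y hy => by
    rw [memT] at hy ⊢
    intro a ha
    rw [h5]
    exact hy _ (hθN a ha)
  -- GEN for `t`: `t = P(θ)` on `T`
  obtain ⟨c, hc⟩ := hG t ht_rat ht_typ
  set Pt : ℚ[X] := ∑ i : Fin d, monomial (i : ℕ) (c i) with hPtdef
  have hPt_app : ∀ y, aeval θ (Pt.map (algebraMap ℚ ℂ)) y = ∑ i : Fin d, ((c i : ℂ) • (θ ^ (i : ℕ)) y) := by
    intro y
    rw [hPtdef, Polynomial.map_sum, map_sum, LinearMap.sum_apply]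
    refine Finset.sum_congr rfl fun i _ => ?_
    rw [Polynomial.map_monomial, aeval_monomial, Module.End.mul_apply, Module.algebraMap_end_apply, eq_ratCast]
  have hPt : ∀ y ∈ T, aeval θ (Pt.map (algebraMap ℚ ℂ)) y = t y := fun y hy => by
    rw [hPt_app, hc y ((memT y).1 hy)]
  -- the eigen-data of polynomials in `θ`
  have poly := fun p : ℚ[X] => aeval_ratPoly_apply hX θ h1 h2 hθσ p
  -- `d ≥ 1` (GEN applied to the identity at `σ ≠ 0`)
  have hd : 1 ≤ d := by
    by_contra hd0
    have hd0' : d = 0 := by omega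
    subst hd0'
    obtain ⟨c₀, hc₀⟩ := hG LinearMap.id (fun y hy => hy) (fun i j y hy => hy)
    have h := hc₀ _ ((memT _).1 hσT)
    rw [LinearMap.id_apply, Finset.univ_eq_empty, Finset.sum_empty] at h
    exact hσne h
  -- `ev = P(ev_θ)`
  have hev : ev = aeval evθ Pt := by
    have h := hPt _ hσT
    rw [(poly Pt).2.2, ht_ev] at h
    exact (smul_left_injective ℂ hσne h).symm
  -- `ev_θ = Q(ev)` by degree count
  obtain ⟨Q, hQ⟩ := exists_aeval_eq_of_natDegree_minpoly_eq hev hd hdegθ hdeg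
  -- `G := (Q ∘ P)(θ) − θ` kills `σ`, hence vanishes on `T`
  have hGσ : aeval θ ((Q.comp Pt - Polynomial.X).map (algebraMap ℚ ℂ)) (LinearEquiv.symm φ z) =
      ((0 : ℚ) : ℂ) • LinearEquiv.symm φ z := by
    rw [(poly _).2.2, map_sub, aeval_comp, ← hev, hQ, aeval_X, sub_self, Rat.cast_zero]
  have hG0 := eq_ratSmul_on_transcendental_of_apply_period hX hM
    (aeval θ ((Q.comp Pt - Polynomial.X).map (algebraMap ℚ ℂ))) (poly _).1 (fun y hy => (poly _).2.1 1 1 y hy) hGσ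
  have hθQP : ∀ y ∈ T, θ y = aeval θ ((Q.comp Pt).map (algebraMap ℚ ℂ)) y := by
    intro y hy
    have h := hG0 y ((memT y).1 hy)
    rw [Rat.cast_zero, zero_smul, Polynomial.map_sub, map_sub, LinearMap.sub_apply, Polynomial.map_X, aeval_X,
      sub_eq_zero] at h
    exact h.symm
  -- `t` preserves `T`; `θ = Q(t)` on `T`
  have htT : ∀ y ∈ T, t y ∈ T := fun y hy => by
    rw [← hPt y hy]
    exact (aeval_apply_eq_of_eqOn T θ θ (fun _ _ => rfl) hθT _ y hy).2
  have hθt : ∀ y ∈ T, θ y = aeval t (Q.map (algebraMap ℚ ℂ)) y := by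
    intro y hy
    rw [hθQP y hy, Polynomial.map_comp, aeval_comp]
    exact (aeval_apply_eq_of_eqOn T _ t hPt htT _ y hy).1
  -- every admissible `f` is a polynomial in `t` on `T`
  intro f hf1 hf2 _ _
  obtain ⟨cf, hcf⟩ := hG f hf1 hf2
  set R : ℚ[X] := ∑ i : Fin d, Polynomial.C (cf i) * Q ^ (i : ℕ) with hRdef
  obtain ⟨n, a, ha⟩ := exists_fin_sum_eq_aeval_ratPoly t R
  refine ⟨n, a, fun y hy => ?_⟩
  have hyT : y ∈ T := (memT y).2 hy
  have hQT : ∀ y ∈ T, aeval t (Q.map (algebraMap ℚ ℂ)) y ∈ T :=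
    fun y hy => (aeval_apply_eq_of_eqOn T t t (fun _ _ => rfl) htT _ y hy).2
  rw [← ha, hcf y hy, hRdef, Polynomial.map_sum, map_sum, LinearMap.sum_apply]
  refine Finset.sum_congr rfl fun i _ => ?_
  rw [Polynomial.map_mul, Polynomial.map_pow, Polynomial.map_C, map_mul, map_pow, Polynomial.aeval_C,
    Module.End.mul_apply, Module.algebraMap_end_apply, eq_ratCast,
    (pow_apply_eq_of_eqOn T θ _ hθt hQT i y hyT).1]

end Summit.HodgeConjecture.HodgeConjecture.Theorems.MarkmanPartnerTransport.PartnerLattice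

end
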